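import Literature.ModelTheory.ExponentialFields.DefinablyMeager
import HarnessLib

/-!
# Definably meager in `Y` versus in an open subset (Fornasiero–Servi 2010, Prop. 2.3, Cor. 2.4)

Topic `Literature/ModelTheory/ExponentialFields`.  A. Fornasiero – T. Servi, *Definably complete
Baire structures*, Fund. Math. 209 (2010), §2: Proposition 2.3 ("Let `Y` be definable, and
`∅ ≠ U ⊆ Y` be definable and open.  Then, `U` is meager in `Y` iff it is meager in itself")
and Corollary 2.4 ("If `U` is not meager in itself, then `Y` is also not meager in itself.  If
`Y` is Baire, then `U` is also Baire"), for the notions of `DefinablyMeager.lean`; the relatively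
open definable subset is written as the trace `O ∩ Y` of an open definable `O ⊆ Mⁿ`.

* **`isDefinablyMeagerIn_inter_iff`** — Prop. 2.3;
* `not_isDefinablyMeagerIn_of_open_subset` and **`IsDefinablyBaireIn.inter_open`** — Cor. 2.4;
* `isDefinablyBaireIn_iff_forall_not_isDefinablyMeagerIn_self` — Lemma 2.5, (1) ⇔ (5);
* `not_isDefinablyMeagerIn_line_of_pi` — Remark 2.8 (if `Mᵐ⁺¹` is not definably meager in itself,
  neither is the line), with `IsNowhereDense.preimage_of_isOpenMap`.

Everything is proved; no definitions, no named facts.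

## References

* A. Fornasiero, T. Servi, *Definably complete Baire structures*, Fund. Math. 209 (2010),
  Prop. 2.3, Cor. 2.4, Lemma 2.5, Remark 2.8. [FornasieroServi2010]
-/

universe u v w

open Set FirstOrder FirstOrder.Language
open _root_.Filter _root_.Topology

namespace Literature.ModelTheory.ExponentialFields

variable {L : FirstOrder.Language.{u, v}} {M : Type w} [L.Structure M] {n : ℕ}
  [TopologicalSpace M] [LE M]

omit [TopologicalSpace M] [LE M] in
/-- Restricting a definable family to a definable set keeps it definable. [folklore] -/
theorem definable_family_inter {A : M → Set (Fin n → M)} {U : Set (Fin n → M)}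
    (hA : (univ : Set M).Definable L {v : Fin (n + 1) → M | Fin.tail v ∈ A (v 0)})
    (hU : (univ : Set M).Definable L U) :
    (univ : Set M).Definable L {v : Fin (n + 1) → M | Fin.tail v ∈ (fun t => A t ∩ U) (v 0)} := by
  have h := hA.inter (hU.preimage_comp Fin.succ)
  refine (congrArg _ ?_).mpr h
  ext v
  simp only [mem_setOf_eq, mem_inter_iff, mem_preimage]
  exact Iff.rfl

omit [L.Structure M] [LE M] in
/-- **Nowhere density passes from `Y` to a relatively open `U = O ∩ Y`** for subsets of `U`.
[cite: FornasieroServi2010, Prop. 2.3] -/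
theorem IsNowhereDenseIn.inter_open {Y O X : Set (Fin n → M)} (hO : IsOpen O)
    (h : IsNowhereDenseIn Y X) : IsNowhereDenseIn (O ∩ Y) (X ∩ (O ∩ Y)) := by
  intro W hW hsub
  have h1 : (W ∩ O) ∩ Y = ∅ := by
    refine h (W ∩ O) (hW.inter hO) fun x hx => ?_
    exact closure_mono inter_subset_left (hsub ⟨hx.1.1, hx.1.2, hx.2⟩)
  ext x
  simp only [mem_inter_iff, mem_empty_iff_false, iff_false, not_and]
  intro hxW hxO hxY
  have : x ∈ (W ∩ O) ∩ Y := ⟨⟨hxW, hxO⟩, hxY⟩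
  rw [h1] at this
  exact this

omit [L.Structure M] [LE M] in
/-- **Nowhere density passes from a relatively open `U = O ∩ Y` to `Y`** for subsets of `U`:
an open `W` meeting `Y` inside `closure (X ∩ U)` meets `U` (as `closure (X ∩ U) ⊆ closure U`),
but `W ∩ O` meets `U` inside `closure X`, so not at all. [cite: FornasieroServi2010, Prop. 2.3] -/
theorem IsNowhereDenseIn.of_inter_open {Y O X : Set (Fin n → M)} (hO : IsOpen O)
    (h : IsNowhereDenseIn (O ∩ Y) X) : IsNowhereDenseIn Y (X ∩ (O ∩ Y)) := by
  intro W hW hsub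
  -- `W ∩ U = ∅`
  have h1 : (W ∩ O) ∩ (O ∩ Y) = ∅ := by
    refine h (W ∩ O) (hW.inter hO) fun x hx => ?_
    exact closure_mono inter_subset_left (hsub ⟨hx.1.1, hx.2.2⟩)
  -- `W ∩ Y ⊆ closure U` forces `W ∩ U ≠ ∅` unless `W ∩ Y = ∅`
  ext x
  simp only [mem_inter_iff, mem_empty_iff_false, iff_false, not_and]
  intro hxW hxY
  have hxcl : x ∈ closure (O ∩ Y) := closure_mono inter_subset_right (hsub ⟨hxW, hxY⟩)
  rw [mem_closure_iff] at hxcl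
  obtain ⟨y, hyW, hyO, hyY⟩ := hxcl W hW hxW
  have : y ∈ (W ∩ O) ∩ (O ∩ Y) := ⟨⟨hyW, hyO⟩, hyO, hyY⟩
  rw [h1] at this
  exact this

/-- **Proposition 2.3** (Fornasiero–Servi 2010): for a definable `Y ⊆ Mⁿ` and an open definable
`O`, the relatively open definable subset `U = O ∩ Y` of `Y` is definably meager in `Y` iff it
is definably meager in itself. [cite: FornasieroServi2010, Prop. 2.3] -/
theorem isDefinablyMeagerIn_inter_iff {Y O : Set (Fin n → M)} (hY : (univ : Set M).Definable L Y)
    (hO : (univ : Set M).Definable L O) (hOo : IsOpen O) :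
    IsDefinablyMeagerIn L Y (O ∩ Y) ↔ IsDefinablyMeagerIn L (O ∩ Y) (O ∩ Y) := by
  have hU : (univ : Set M).Definable L (O ∩ Y) := hO.inter hY
  constructor
  · rintro ⟨A, hA, hnd, hinc, hcov⟩
    refine ⟨fun t => A t ∩ (O ∩ Y), definable_family_inter hA hU,
      fun t => (hnd t).inter_open hOo,
      fun s t hst => inter_subset_inter_left _ (hinc s t hst), fun x hx => ?_⟩
    obtain ⟨t, ht⟩ := mem_iUnion.1 (hcov hx)
    exact mem_iUnion.2 ⟨t, ht, hx⟩
  · rintro ⟨A, hA, hnd, hinc, hcov⟩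
    refine ⟨fun t => A t ∩ (O ∩ Y), definable_family_inter hA hU,
      fun t => (hnd t).of_inter_open hOo,
      fun s t hst => inter_subset_inter_left _ (hinc s t hst), fun x hx => ?_⟩
    obtain ⟨t, ht⟩ := mem_iUnion.1 (hcov hx)
    exact mem_iUnion.2 ⟨t, ht, hx⟩

/-- **Corollary 2.4, first part** (Fornasiero–Servi 2010): if the relatively open definable
`U = O ∩ Y` is not definably meager in itself, then `Y` is not definably meager in itself.
[cite: FornasieroServi2010, Cor. 2.4] -/
theorem not_isDefinablyMeagerIn_of_open_subset {Y O : Set (Fin n → M)}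
    (hY : (univ : Set M).Definable L Y) (hO : (univ : Set M).Definable L O) (hOo : IsOpen O)
    (hU : ¬ IsDefinablyMeagerIn L (O ∩ Y) (O ∩ Y)) : ¬ IsDefinablyMeagerIn L Y Y := fun h =>
  hU ((isDefinablyMeagerIn_inter_iff hY hO hOo).1 (h.mono inter_subset_right))

/-- **Corollary 2.4, second part** (Fornasiero–Servi 2010): a relatively open definable subset
`U = O ∩ Y` of a definably Baire definable `Y` is definably Baire. [cite: FornasieroServi2010, Cor. 2.4] -/
theorem IsDefinablyBaireIn.inter_open {Y O : Set (Fin n → M)} (hB : IsDefinablyBaireIn L Y)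
    (hY : (univ : Set M).Definable L Y) (hO : (univ : Set M).Definable L O) (hOo : IsOpen O) :
    IsDefinablyBaireIn L (O ∩ Y) := by
  intro O' hO' hO'o hne hmeag
  -- `V = (O' ∩ O) ∩ Y` is relatively open in `Y` and in `U`
  have hV : O' ∩ (O ∩ Y) = (O' ∩ O) ∩ Y := (inter_assoc _ _ _).symm
  have hne' : ((O' ∩ O) ∩ Y).Nonempty := by rwa [← hV]
  -- meager in `U` ⇒ meager in itself ⇒ meager in `Y`
  have h1 : IsDefinablyMeagerIn L (O' ∩ (O ∩ Y)) (O' ∩ (O ∩ Y)) :=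
    (isDefinablyMeagerIn_inter_iff (hO.inter hY) hO' hO'o).1 hmeag
  rw [hV] at h1
  have h2 : IsDefinablyMeagerIn L Y ((O' ∩ O) ∩ Y) :=
    (isDefinablyMeagerIn_inter_iff hY (hO'.inter hO) (hO'o.inter hOo)).2 h1
  exact hB (O' ∩ O) (hO'.inter hO) (hO'o.inter hOo) hne' h2

/-- **Lemma 2.5, (1) ⇔ (5)** (Fornasiero–Servi 2010): a definable `Y` is definably Baire iff
every non-empty relatively open definable subset `O ∩ Y` is not definably meager *in itself*.
[cite: FornasieroServi2010, Lemma 2.5] -/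
theorem isDefinablyBaireIn_iff_forall_not_isDefinablyMeagerIn_self {Y : Set (Fin n → M)}
    (hY : (univ : Set M).Definable L Y) :
    IsDefinablyBaireIn L Y ↔ ∀ O : Set (Fin n → M), (univ : Set M).Definable L O → IsOpen O →
      (O ∩ Y).Nonempty → ¬ IsDefinablyMeagerIn L (O ∩ Y) (O ∩ Y) := by
  refine forall_congr' fun O => forall_congr' fun hO => forall_congr' fun hOo =>
    forall_congr' fun _ => ?_
  rw [isDefinablyMeagerIn_inter_iff hY hO hOo]

/-! ### Remark 2.8: if some `Mᵐ` is Baire then the line is -/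

omit [L.Structure M] [LE M] in
/-- The preimage of a nowhere dense set under a continuous open map is nowhere dense.
[folklore] -/
theorem IsNowhereDense.preimage_of_isOpenMap {α β : Type*} [TopologicalSpace α]
    [TopologicalSpace β] {f : α → β} (hf : Continuous f) (hfo : IsOpenMap f) {s : Set β}
    (hs : IsNowhereDense s) : IsNowhereDense (f ⁻¹' s) := by
  rw [IsNowhereDense] at hs ⊢
  apply subset_empty_iff.1
  calc interior (closure (f ⁻¹' s)) ⊆ interior (f ⁻¹' closure s) :=
        interior_mono (hf.closure_preimage_subset s)
    _ = f ⁻¹' interior (closure s) := (hfo.preimage_interior_eq_interior_preimage hf _).symm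
    _ = ∅ := by rw [hs, preimage_empty]

/-- **Remark 2.8** (Fornasiero–Servi 2010: "If `Kᵐ` is Baire for some `m ≥ 1`, then `K` is
Baire"), in the form: if `Mᵐ⁺¹` is not definably meager in itself then neither is the line
(a meager cover `(A t)` of the line pulls back along the first coordinate to a meager cover of
`Mᵐ⁺¹`). [cite: FornasieroServi2010, Remark 2.8] -/
theorem not_isDefinablyMeagerIn_line_of_pi {m : ℕ}
    (h : ¬ IsDefinablyMeagerIn L (univ : Set (Fin (m + 1) → M)) univ) :
    ¬ IsDefinablyMeagerIn L (univ : Set (Fin 1 → M)) univ := by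
  rintro ⟨A, hA, hnd, hinc, hcov⟩
  -- `B t = {x | (x 0) ∈ A t}` as `1`-tuples
  refine h ⟨fun t => {x : Fin (m + 1) → M | (![x 0] : Fin 1 → M) ∈ A t}, ?_, fun t => ?_,
    fun s t hst x hx => hinc s t hst hx, fun x _ => ?_⟩
  · -- definability: pull back the defining set of `A` along `v ↦ (v 0, v 1)`
    have h1 := hA.preimage_comp (![0, 1] : Fin 2 → Fin (m + 2))
    refine (congrArg _ ?_).mpr h1
    ext v
    simp only [mem_setOf_eq, mem_preimage]
    refine Iff.of_eq (congrArg (· ∈ A _) ?_)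
    funext i
    fin_cases i
    rfl
  · -- nowhere density: preimage under the open continuous first projection
    rw [isNowhereDenseIn_univ_iff]
    have h2 := hnd t
    rw [isNowhereDenseIn_univ_iff] at h2
    have hS : {x : Fin 1 → M | x 0 ∈ {y : M | (![y] : Fin 1 → M) ∈ A t}} = A t := by
      ext x
      simp only [mem_setOf_eq]
      rw [show (![x 0] : Fin 1 → M) = x from by funext i; fin_cases i; rfl]
    have h3 : IsNowhereDense {y : M | (![y] : Fin 1 → M) ∈ A t} := by
      rw [← isNowhereDense_setOf_apply_mem_iff, hS]
      exact h2
    exact IsNowhereDense.preimage_of_isOpenMap (f := fun x : Fin (m + 1) → M => x 0)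
      (continuous_apply 0) (isOpenMap_eval 0) h3
  · obtain ⟨t, ht⟩ := mem_iUnion.1 (hcov (mem_univ (![x 0] : Fin 1 → M)))
    exact mem_iUnion.2 ⟨t, ht⟩

end Literature.ModelTheory.ExponentialFields
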